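import Literature.Combinatorics.Additive.TripleProductProperty
import Summits.MatrixMultiplication.MatrixMultiplication.Theorems.AutomaticSTPPDesignsSmallScalesSufficePumping

/-!
# MatrixMultiplication / AutomaticSTPPDesigns — `SmallScalesSuffice`, violations as lists of letters

Route `AutomaticSTPPDesigns`, support item `SmallScalesSuffice` (stmt-MatrixMultiplication-7360).
The digit-block family of three DFAs `MA, MB, MC` over `ι × Fin p` at scale `k` is indexed by
`w : Fin k → ι`, the block of `w` being the set of values `∑ j, a j * p ^ j (mod p ^ k)` of the
digit strings `a : Fin k → Fin p` such that the word `((w 0, a 0), …, (w (k-1), a (k-1)))` is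
accepted.
Here a failure of `AddSimultaneousTPP` (CKSU 2005, Def. 5.1, either clause) at scale `k` is
translated into a *violating list* of `k` letters and back (`smallScales_extract`,
`smallScales_realize`); the blocks enter only through their membership characterisation, so the
lemmas apply verbatim to the `let`-bound blocks of the route statement.
-/

-- the tree's namespace `Summit.MatrixMultiplication.MatrixMultiplication.…` repeats a component by
-- design
set_option linter.dupNamespace false

namespace Summit.MatrixMultiplication.MatrixMultiplication.Theorems

open Literature.Combinatorics.Additive

/-! ## Violations as lists of letters

A letter carries three index symbols `(w₁, w₂, w₃)` and six digits `((a, a'), (b, b'), (c, c'))`;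
the six DFA runs read `(w₁, a)`, `(w₂, a')` (by `MA`), `(w₂, b)`, `(w₃, b')` (by `MB`),
`(w₃, c)`, `(w₁, c')` (by `MC`), as in clause (ii) of CKSU Def. 5.1; clause (i) is the case
`w₁ = w₂ = w₃` with the flag "some digit pair differs". -/

section Letters

variable {ι σA σB σC : Type} {p : ℕ} (MA : DFA (ι × Fin p) σA) (MB : DFA (ι × Fin p) σB)
  (MC : DFA (ι × Fin p) σC)

/-- **Extraction.** A failure of `AddSimultaneousTPP` for the digit-block family at scale `k`
yields a violating list of `k` letters: six accepted runs, signed digit sum divisible by `p ^ k`,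
and an inequality flag (of clause (ii), or of clause (i) together with equal index tracks).
[folklore] -/
theorem smallScales_extract {k : ℕ} (A B C : (Fin k → ι) → Finset (ZMod (p ^ k)))
    (hA : ∀ (w : Fin k → ι) (z : ZMod (p ^ k)), z ∈ A w ↔ ∃ a : Fin k → Fin p,
      List.ofFn (fun j => (w j, a j)) ∈ MA.accepts ∧
        ((∑ j : Fin k, (a j : ℕ) * p ^ (j : ℕ) : ℕ) : ZMod (p ^ k)) = z)
    (hB : ∀ (w : Fin k → ι) (z : ZMod (p ^ k)), z ∈ B w ↔ ∃ a : Fin k → Fin p,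
      List.ofFn (fun j => (w j, a j)) ∈ MB.accepts ∧
        ((∑ j : Fin k, (a j : ℕ) * p ^ (j : ℕ) : ℕ) : ZMod (p ^ k)) = z)
    (hC : ∀ (w : Fin k → ι) (z : ZMod (p ^ k)), z ∈ C w ↔ ∃ a : Fin k → Fin p,
      List.ofFn (fun j => (w j, a j)) ∈ MC.accepts ∧
        ((∑ j : Fin k, (a j : ℕ) * p ^ (j : ℕ) : ℕ) : ZMod (p ^ k)) = z)
    (hnot : ¬ AddSimultaneousTPP A B C) :
    ∃ l : List ((ι × ι × ι) × ((Fin p × Fin p) × (Fin p × Fin p) × (Fin p × Fin p))),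
      l.length = k ∧
      (List.map (fun x => (x.1.1, x.2.1.1)) l ∈ MA.accepts ∧
        List.map (fun x => (x.1.2.1, x.2.1.2)) l ∈ MA.accepts ∧
        List.map (fun x => (x.1.2.1, x.2.2.1.1)) l ∈ MB.accepts ∧
        List.map (fun x => (x.1.2.2, x.2.2.1.2)) l ∈ MB.accepts ∧
        List.map (fun x => (x.1.2.2, x.2.2.2.1)) l ∈ MC.accepts ∧
        List.map (fun x => (x.1.1, x.2.2.2.2)) l ∈ MC.accepts) ∧
      (p : ℤ) ^ k ∣ ((Nat.ofDigits p (List.map (fun x => (x.2.1.1 : ℕ)) l) : ℕ) : ℤ)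
          - ((Nat.ofDigits p (List.map (fun x => (x.2.1.2 : ℕ)) l) : ℕ) : ℤ)
          + ((Nat.ofDigits p (List.map (fun x => (x.2.2.1.1 : ℕ)) l) : ℕ) : ℤ)
          - ((Nat.ofDigits p (List.map (fun x => (x.2.2.1.2 : ℕ)) l) : ℕ) : ℤ)
          + ((Nat.ofDigits p (List.map (fun x => (x.2.2.2.1 : ℕ)) l) : ℕ) : ℤ)
          - ((Nat.ofDigits p (List.map (fun x => (x.2.2.2.2 : ℕ)) l) : ℕ) : ℤ) ∧
      ((∃ x ∈ l, (x.1.1 ≠ x.1.2.1 ∨ x.1.2.1 ≠ x.1.2.2)) ∨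
        ((∀ x ∈ l, (x.1.1 = x.1.2.1 ∧ x.1.2.1 = x.1.2.2)) ∧
          ∃ x ∈ l, (x.2.1.1 ≠ x.2.1.2 ∨ x.2.2.1.1 ≠ x.2.2.1.2 ∨ x.2.2.2.1 ≠ x.2.2.2.2))) := by
  classical
  by_cases h1 : ∀ i, AddTripleProductProperty (A i) (B i) (C i)
  · -- clause (ii) fails
    have h2 : ¬ ∀ i j k', ∀ a ∈ A i, ∀ a' ∈ A j, ∀ b ∈ B j, ∀ b' ∈ B k', ∀ c ∈ C k', ∀ c' ∈ C i,
        a + -a' + b + -b' + c + -c' = 0 → i = j ∧ j = k' := fun h2 => hnot ⟨h1, h2⟩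
    push Not at h2
    obtain ⟨w₁, w₂, w₃, s, hs, s', hs', t, ht, t', ht', u, hu, u', hu', hsum, hne⟩ := h2
    obtain ⟨a, ha, rfl⟩ := (hA w₁ s).mp hs
    obtain ⟨a', ha', rfl⟩ := (hA w₂ s').mp hs'
    obtain ⟨b, hb, rfl⟩ := (hB w₂ t).mp ht
    obtain ⟨b', hb', rfl⟩ := (hB w₃ t').mp ht'
    obtain ⟨c, hc, rfl⟩ := (hC w₃ u).mp hu
    obtain ⟨c', hc', rfl⟩ := (hC w₁ u').mp hu'
    refine ⟨List.ofFn (fun j => ((w₁ j, w₂ j, w₃ j), ((a j, a' j), (b j, b' j), (c j, c' j)))),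
      List.length_ofFn, ?_, ?_, Or.inl ?_⟩
    · simp only [List.map_ofFn]
      exact ⟨ha, ha', hb, hb', hc, hc'⟩
    · simp only [List.map_ofFn, Function.comp_def, smallScales_ofDigits_ofFn]
      generalize (∑ j : Fin k, (a j : ℕ) * p ^ (j : ℕ)) = na at hsum ⊢
      generalize (∑ j : Fin k, (a' j : ℕ) * p ^ (j : ℕ)) = na' at hsum ⊢
      generalize (∑ j : Fin k, (b j : ℕ) * p ^ (j : ℕ)) = nb at hsum ⊢
      generalize (∑ j : Fin k, (b' j : ℕ) * p ^ (j : ℕ)) = nb' at hsum ⊢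
      generalize (∑ j : Fin k, (c j : ℕ) * p ^ (j : ℕ)) = nc at hsum ⊢
      generalize (∑ j : Fin k, (c' j : ℕ) * p ^ (j : ℕ)) = nc' at hsum ⊢
      have h0 : (((na : ℤ) - na' + nb - nb' + nc - nc' : ℤ) : ZMod (p ^ k)) = 0 := by
        push_cast
        linear_combination hsum
      have h0' := (ZMod.intCast_zmod_eq_zero_iff_dvd _ _).mp h0
      push_cast at h0'
      exact h0'
    · by_contra hcon
      push Not at hcon
      have e : ∀ j, w₁ j = w₂ j ∧ w₂ j = w₃ j := fun j => hcon _ (List.mem_ofFn.mpr ⟨j, rfl⟩)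
      exact hne (funext fun j => (e j).1) (funext fun j => (e j).2)
  · -- clause (i) fails
    simp only [AddTripleProductProperty] at h1
    push Not at h1
    obtain ⟨w, s, hs, s', hs', t, ht, t', ht', u, hu, u', hu', hsum, hne⟩ := h1
    obtain ⟨a, ha, rfl⟩ := (hA w s).mp hs
    obtain ⟨a', ha', rfl⟩ := (hA w s').mp hs'
    obtain ⟨b, hb, rfl⟩ := (hB w t).mp ht
    obtain ⟨b', hb', rfl⟩ := (hB w t').mp ht'
    obtain ⟨c, hc, rfl⟩ := (hC w u).mp hu
    obtain ⟨c', hc', rfl⟩ := (hC w u').mp hu'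
    refine ⟨List.ofFn (fun j => ((w j, w j, w j), ((a j, a' j), (b j, b' j), (c j, c' j)))),
      List.length_ofFn, ?_, ?_, Or.inr ⟨?_, ?_⟩⟩
    · simp only [List.map_ofFn]
      exact ⟨ha, ha', hb, hb', hc, hc'⟩
    · simp only [List.map_ofFn, Function.comp_def, smallScales_ofDigits_ofFn]
      generalize (∑ j : Fin k, (a j : ℕ) * p ^ (j : ℕ)) = na at hsum ⊢
      generalize (∑ j : Fin k, (a' j : ℕ) * p ^ (j : ℕ)) = na' at hsum ⊢
      generalize (∑ j : Fin k, (b j : ℕ) * p ^ (j : ℕ)) = nb at hsum ⊢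
      generalize (∑ j : Fin k, (b' j : ℕ) * p ^ (j : ℕ)) = nb' at hsum ⊢
      generalize (∑ j : Fin k, (c j : ℕ) * p ^ (j : ℕ)) = nc at hsum ⊢
      generalize (∑ j : Fin k, (c' j : ℕ) * p ^ (j : ℕ)) = nc' at hsum ⊢
      have h0 : (((na : ℤ) - na' + nb - nb' + nc - nc' : ℤ) : ZMod (p ^ k)) = 0 := by
        push_cast
        linear_combination hsum
      have h0' := (ZMod.intCast_zmod_eq_zero_iff_dvd _ _).mp h0
      push_cast at h0'
      exact h0'
    · intro x hx
      obtain ⟨j, rfl⟩ := List.mem_ofFn.mp hx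
      exact ⟨rfl, rfl⟩
    · by_contra hcon
      push Not at hcon
      have e : ∀ j, a j = a' j ∧ b j = b' j ∧ c j = c' j :=
        fun j => hcon _ (List.mem_ofFn.mpr ⟨j, rfl⟩)
      have haa : a = a' := funext fun j => (e j).1
      have hbb : b = b' := funext fun j => (e j).2.1
      have hcc : c = c' := funext fun j => (e j).2.2
      subst haa hbb hcc
      exact hne rfl rfl rfl

/-- **Realization.** Conversely, a violating list of letters of length `k` exhibits a failure of
`AddSimultaneousTPP` for the digit-block family at scale `k`. [folklore] -/
theorem smallScales_realize
    (l : List ((ι × ι × ι) × ((Fin p × Fin p) × (Fin p × Fin p) × (Fin p × Fin p))))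
    (A B C : (Fin l.length → ι) → Finset (ZMod (p ^ l.length)))
    (hA : ∀ (w : Fin l.length → ι) (z : ZMod (p ^ l.length)), z ∈ A w ↔
      ∃ a : Fin l.length → Fin p, List.ofFn (fun j => (w j, a j)) ∈ MA.accepts ∧
        ((∑ j : Fin l.length, (a j : ℕ) * p ^ (j : ℕ) : ℕ) : ZMod (p ^ l.length)) = z)
    (hB : ∀ (w : Fin l.length → ι) (z : ZMod (p ^ l.length)), z ∈ B w ↔
      ∃ a : Fin l.length → Fin p, List.ofFn (fun j => (w j, a j)) ∈ MB.accepts ∧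
        ((∑ j : Fin l.length, (a j : ℕ) * p ^ (j : ℕ) : ℕ) : ZMod (p ^ l.length)) = z)
    (hC : ∀ (w : Fin l.length → ι) (z : ZMod (p ^ l.length)), z ∈ C w ↔
      ∃ a : Fin l.length → Fin p, List.ofFn (fun j => (w j, a j)) ∈ MC.accepts ∧
        ((∑ j : Fin l.length, (a j : ℕ) * p ^ (j : ℕ) : ℕ) : ZMod (p ^ l.length)) = z)
    (hacc : List.map (fun x => (x.1.1, x.2.1.1)) l ∈ MA.accepts ∧
        List.map (fun x => (x.1.2.1, x.2.1.2)) l ∈ MA.accepts ∧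
        List.map (fun x => (x.1.2.1, x.2.2.1.1)) l ∈ MB.accepts ∧
        List.map (fun x => (x.1.2.2, x.2.2.1.2)) l ∈ MB.accepts ∧
        List.map (fun x => (x.1.2.2, x.2.2.2.1)) l ∈ MC.accepts ∧
        List.map (fun x => (x.1.1, x.2.2.2.2)) l ∈ MC.accepts)
    (hdiv : (p : ℤ) ^ l.length ∣ ((Nat.ofDigits p (List.map (fun x => (x.2.1.1 : ℕ)) l) : ℕ) : ℤ)
          - ((Nat.ofDigits p (List.map (fun x => (x.2.1.2 : ℕ)) l) : ℕ) : ℤ)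
          + ((Nat.ofDigits p (List.map (fun x => (x.2.2.1.1 : ℕ)) l) : ℕ) : ℤ)
          - ((Nat.ofDigits p (List.map (fun x => (x.2.2.1.2 : ℕ)) l) : ℕ) : ℤ)
          + ((Nat.ofDigits p (List.map (fun x => (x.2.2.2.1 : ℕ)) l) : ℕ) : ℤ)
          - ((Nat.ofDigits p (List.map (fun x => (x.2.2.2.2 : ℕ)) l) : ℕ) : ℤ))
    (hbad : ((∃ x ∈ l, (x.1.1 ≠ x.1.2.1 ∨ x.1.2.1 ≠ x.1.2.2)) ∨
        ((∀ x ∈ l, (x.1.1 = x.1.2.1 ∧ x.1.2.1 = x.1.2.2)) ∧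
          ∃ x ∈ l, (x.2.1.1 ≠ x.2.1.2 ∨ x.2.2.1.1 ≠ x.2.2.1.2 ∨ x.2.2.2.1 ≠ x.2.2.2.2)))) :
    ¬ AddSimultaneousTPP A B C := by
  classical
  intro hT
  obtain ⟨hr0, hr1, hr2, hr3, hr4, hr5⟩ := hacc
  -- index tracks and digit strings read off the list
  set w₁ : Fin l.length → ι := fun j => (l.get j).1.1 with hw₁
  set w₂ : Fin l.length → ι := fun j => (l.get j).1.2.1 with hw₂
  set w₃ : Fin l.length → ι := fun j => (l.get j).1.2.2 with hw₃
  set a : Fin l.length → Fin p := fun j => (l.get j).2.1.1 with ha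
  set a' : Fin l.length → Fin p := fun j => (l.get j).2.1.2 with ha'
  set b : Fin l.length → Fin p := fun j => (l.get j).2.2.1.1 with hb
  set b' : Fin l.length → Fin p := fun j => (l.get j).2.2.1.2 with hb'
  set c : Fin l.length → Fin p := fun j => (l.get j).2.2.2.1 with hc
  set c' : Fin l.length → Fin p := fun j => (l.get j).2.2.2.2 with hc'
  -- the six memberships
  have hs : ((∑ j, (a j : ℕ) * p ^ (j : ℕ) : ℕ) : ZMod (p ^ l.length)) ∈ A w₁ :=
    (hA w₁ _).mpr ⟨a, by
      rw [show List.ofFn (fun j => (w₁ j, a j)) = _ from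
        smallScales_ofFn_get_comp l (fun x => (x.1.1, x.2.1.1))]; exact hr0, rfl⟩
  have hs' : ((∑ j, (a' j : ℕ) * p ^ (j : ℕ) : ℕ) : ZMod (p ^ l.length)) ∈ A w₂ :=
    (hA w₂ _).mpr ⟨a', by
      rw [show List.ofFn (fun j => (w₂ j, a' j)) = _ from
        smallScales_ofFn_get_comp l (fun x => (x.1.2.1, x.2.1.2))]; exact hr1, rfl⟩
  have ht : ((∑ j, (b j : ℕ) * p ^ (j : ℕ) : ℕ) : ZMod (p ^ l.length)) ∈ B w₂ :=
    (hB w₂ _).mpr ⟨b, by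
      rw [show List.ofFn (fun j => (w₂ j, b j)) = _ from
        smallScales_ofFn_get_comp l (fun x => (x.1.2.1, x.2.2.1.1))]; exact hr2, rfl⟩
  have ht' : ((∑ j, (b' j : ℕ) * p ^ (j : ℕ) : ℕ) : ZMod (p ^ l.length)) ∈ B w₃ :=
    (hB w₃ _).mpr ⟨b', by
      rw [show List.ofFn (fun j => (w₃ j, b' j)) = _ from
        smallScales_ofFn_get_comp l (fun x => (x.1.2.2, x.2.2.1.2))]; exact hr3, rfl⟩
  have hu : ((∑ j, (c j : ℕ) * p ^ (j : ℕ) : ℕ) : ZMod (p ^ l.length)) ∈ C w₃ :=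
    (hC w₃ _).mpr ⟨c, by
      rw [show List.ofFn (fun j => (w₃ j, c j)) = _ from
        smallScales_ofFn_get_comp l (fun x => (x.1.2.2, x.2.2.2.1))]; exact hr4, rfl⟩
  have hu' : ((∑ j, (c' j : ℕ) * p ^ (j : ℕ) : ℕ) : ZMod (p ^ l.length)) ∈ C w₁ :=
    (hC w₁ _).mpr ⟨c', by
      rw [show List.ofFn (fun j => (w₁ j, c' j)) = _ from
        smallScales_ofFn_get_comp l (fun x => (x.1.1, x.2.2.2.2))]; exact hr5, rfl⟩
  -- the six values
  have hv : ∀ d : ((ι × ι × ι) × ((Fin p × Fin p) × (Fin p × Fin p) × (Fin p × Fin p))) → ℕ,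
      Nat.ofDigits p (List.map d l) = ∑ j : Fin l.length, d (l.get j) * p ^ (j : ℕ) := by
    intro d
    rw [← smallScales_ofFn_get_comp l d, smallScales_ofDigits_ofFn]
  rw [hv (fun x => (x.2.1.1 : ℕ)), hv (fun x => (x.2.1.2 : ℕ)), hv (fun x => (x.2.2.1.1 : ℕ)),
    hv (fun x => (x.2.2.1.2 : ℕ)), hv (fun x => (x.2.2.2.1 : ℕ)), hv (fun x => (x.2.2.2.2 : ℕ))]
    at hdiv
  change (p : ℤ) ^ l.length ∣ ((∑ j, (a j : ℕ) * p ^ (j : ℕ) : ℕ) : ℤ)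
      - ((∑ j, (a' j : ℕ) * p ^ (j : ℕ) : ℕ) : ℤ) + ((∑ j, (b j : ℕ) * p ^ (j : ℕ) : ℕ) : ℤ)
      - ((∑ j, (b' j : ℕ) * p ^ (j : ℕ) : ℕ) : ℤ) + ((∑ j, (c j : ℕ) * p ^ (j : ℕ) : ℕ) : ℤ)
      - ((∑ j, (c' j : ℕ) * p ^ (j : ℕ) : ℕ) : ℤ) at hdiv
  generalize hna : (∑ j, (a j : ℕ) * p ^ (j : ℕ)) = na at hs hdiv
  generalize hna' : (∑ j, (a' j : ℕ) * p ^ (j : ℕ)) = na' at hs' hdiv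
  generalize hnb : (∑ j, (b j : ℕ) * p ^ (j : ℕ)) = nb at ht hdiv
  generalize hnb' : (∑ j, (b' j : ℕ) * p ^ (j : ℕ)) = nb' at ht' hdiv
  generalize hnc : (∑ j, (c j : ℕ) * p ^ (j : ℕ)) = nc at hu hdiv
  generalize hnc' : (∑ j, (c' j : ℕ) * p ^ (j : ℕ)) = nc' at hu' hdiv
  have h0 : (((na : ℤ) - na' + nb - nb' + nc - nc' : ℤ) : ZMod (p ^ l.length)) = 0 := by
    rw [ZMod.intCast_zmod_eq_zero_iff_dvd]
    push_cast
    exact hdiv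
  push_cast at h0
  rcases hbad with ⟨x, hx, hbx⟩ | ⟨hgood, x, hx, hbx⟩
  · -- clause (ii) is violated
    have h0' : (na : ZMod (p ^ l.length)) + -(na' : ZMod (p ^ l.length)) + nb
        + -(nb' : ZMod (p ^ l.length)) + nc + -(nc' : ZMod (p ^ l.length)) = 0 := by
      linear_combination h0
    obtain ⟨h12, h23⟩ := hT.2 w₁ w₂ w₃ _ hs _ hs' _ ht _ ht' _ hu _ hu' h0'
    obtain ⟨n, hn, rfl⟩ := List.getElem_of_mem hx
    have e12 := congrFun h12 ⟨n, hn⟩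
    have e23 := congrFun h23 ⟨n, hn⟩
    simp only [hw₁, hw₂, hw₃, List.get_eq_getElem] at e12 e23
    rcases hbx with h | h
    · exact h e12
    · exact h e23
  · -- clause (i) is violated
    have h12 : w₁ = w₂ := funext fun j => (hgood _ (List.get_mem l j)).1
    have h23 : w₂ = w₃ := funext fun j => (hgood _ (List.get_mem l j)).2
    rw [← h12] at hs' ht
    rw [← h23, ← h12] at ht' hu
    have h0'' : (na : ZMod (p ^ l.length)) + -(na' : ZMod (p ^ l.length))
        + ((nb : ZMod (p ^ l.length)) + -(nb' : ZMod (p ^ l.length)))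
        + ((nc : ZMod (p ^ l.length)) + -(nc' : ZMod (p ^ l.length))) = 0 := by
      linear_combination h0
    obtain ⟨e1, e2, e3⟩ := hT.1 w₁ _ hs _ hs' _ ht _ ht' _ hu _ hu' h0''
    subst hna hna' hnb hnb' hnc hnc'
    have haa := smallScales_digits_eq_of_cast_eq a a' e1
    have hbb := smallScales_digits_eq_of_cast_eq b b' e2
    have hcc := smallScales_digits_eq_of_cast_eq c c' e3
    obtain ⟨n, hn, rfl⟩ := List.getElem_of_mem hx
    have ea := congrFun haa ⟨n, hn⟩
    have eb := congrFun hbb ⟨n, hn⟩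
    have ec := congrFun hcc ⟨n, hn⟩
    simp only [ha, ha', hb, hb', hc, hc', List.get_eq_getElem] at ea eb ec
    rcases hbx with h | h | h
    · exact h ea
    · exact h eb
    · exact h ec

end Letters

end Summit.MatrixMultiplication.MatrixMultiplication.Theorems
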